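import Summits.BirchSwinnertonDyer.BirchSwinnertonDyer.Theorems.AdditiveBranchIMCGenusKolyvaginPointsR
import HarnessLib

/-!
# Crux `EulerHalfPOnlyMultPotMultTwinAtFive` (item stmt-BirchSwinnertonDyer-23444, route `ErratumRoadFive`), line
# `genus` — stub S2 `stub_genusKolyvaginPointsRC` CLOSED MODULO THE PRINTED FACTS IT CONSUMES, for a general
# presentation `W = C₂ • (D • E′)^{(d₁)}`

Seat `bsd-stepL-genus-p1` (cell `bsd-stepL`, HOME `run/shared/lean/pub/bsd-stepL/`), helper `--supports
stmt-BirchSwinnertonDyer-23444`. THEOREMS ONLY (no definition, no named fact, no `sorry`).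

## What

The registered stub S2 of `Cruxes/EulerHalfPOnlyMultPotMultTwinAtFive/Lines/genus.lean` (v1.2′) is
`stub_genusKolyvaginPointsRC : GenusKolyvaginPointsSupply` — for every genus Heegner setting
`S : GenusHeegnerSettingRC W A p q K` on the served `FrameProfile`, the transported genus Heegner point `S.P ∈ W(K)`
carries a RING-CLASS-RATIONAL KOLYVAGIN DATUM `GenusKolyvaginPointsR W p K S.ιc S.P` (admissible `τ`-stable
modules rational over embedded `K[m]`, `P_1 = P`, `cP − εP` torsion, Gross 5.4 (1) eigen relation, McCallum 4.4
switch). Its mathematics is Gross 1991 §§3–5 for the CM points of the fourth curve `E′` on `X₀(N_{E′})` over the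
ring class fields `K[m]` of a field `K` in which one prime `q ∥ N_{E′}` RAMIFIES (Birch's Heegner condition, not
Gross's), pushed through the `K[1]`-isomorphism `Φ = (C₂)_* ∘ ι_θ⁻¹ ∘ D_*`. The cell `bsd-addord` (crux 19357, twin
`MultLower`, SAME currency `GenusKolyvaginPointsR[M]`) landed exactly this as
`GenusKolyvagin.genusKolyvaginPointsR_of_facts` (module `AdditiveBranchIMCGenusKolyvaginPointsR`) for the
literal curve `C₂ • (D • E′)^{(d₁)}`, GIVEN four printed facts BY NAME.

This file: (§1) the discriminant bound `d_K < −4` from the genus factorisation `d_K = d₁·d₂` into two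
fundamental discriminants `≠ 1` (so it is NOT an extra hypothesis of the stub); (§2)
`genusKolyvaginPointsR_of_presentation` — the conclusion of `GenusKolyvaginPointsR W p K ιc P` (VERBATIM the body
of the line's def, for a GENERAL globally minimal `W` presented as `C₂ • (D • E′)^{(d₁)} = W`, the transported point
`P` keyed through `Affine.Point.congrEquiv` exactly as the field `GenusHeegnerSettingRC.hP` states it) from the
setting's fields, `5 ≤ p`, `ρ̄_{W,p}` onto, and the four facts; the modularity input `hmodP` is, in the
route's own currency `exists_isNewformOf` (= ER5 item `NewformOfEllipticCurve`, BY NAME), ONE tree theorem away: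
`maninLocalTwoThree_nonempty_modularParametrizationData_of_exists_isNewformOf` (module
`ManinLocalTwoThreeManinOddAtFourDyadicTwistConductor`; the rational Manin constant is the tree's theorem
`IsNewformOf.exists_maninConstant_ne_zero_holds`).

HONEST FRAMING. Conditional on: (G1) `phi_heegnerPointOfConductor_mem_range_map_ringClassField_birch` (Darmon 2004
Thm 3.6 ∕ Gross 1984 §I.3: CM points of conductor `n` rational over `K[n]` under Birch's condition — no algebraic
model of `X₀(N)` over `ℚ` in the tree), (B5) `Nekovar2007.cmPoint_frobeniusCongruence` (Prop. 4.9; Gross's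
split-keyed 3.7 (2) does not cover the `q`-ramified `K`), (B3) `GrossLMS1991.prop53_conj_pinned_birch` (Prop. 5.3,
pinned), and modularity. The registered signature `GenusKolyvaginPointsSupply` binds none of them, so this helper
closes S2 only after the skeleton binds these facts BY NAME (reshape proposed to the pen; see the seat's evidence
note on the item). The crux, its parent 19715 and BSD stay OPEN; BSD is proved for no curve.
[cite: GrossLMS1991, §§3–5 (Props. 3.7, 5.3, 5.4)] [cite: McCallumLMS1991, §4 (4)–(6), Prop. 4.4]
[cite: Nekovar2007, Prop. 4.9] [cite: Darmon2004, Thm. 3.6] [cite: BCDTJAMS2001, p. 845 (2) ⇒ (6)]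
presearch: "Heegner points ring class field Birch condition ramified prime Kolyvagin system genus character" →
[corpus: Darmon2004 Thm 3.6; Nekovar2007 Prop 4.9; GrossLMS1991 Prop 5.3] are the three named facts themselves
(typed in the tree as defs, undischarged); no tree theorem supplies CM points of conductor `n > 1`.
-/

noncomputable section

open scoped Classical

set_option linter.dupNamespace false -- the summit-side namespace `…BirchSwinnertonDyer.BirchSwinnertonDyer…` (D-0017 nesting) repeats a component by design
set_option autoImplicit false

namespace Summit.BirchSwinnertonDyer.BirchSwinnertonDyer.Theorems.GenusKolyvaginRC

open WeierstrassCurve NumberField Field IsDedekindDomain Literature.NumberTheory.EllipticCurves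
  Literature.NumberTheory.EllipticCurves.ModularForms

/-! ### §1 The discriminant of a genus field is `< −4` -/

/-- A fundamental discriminant `≠ 1` in Gross's shape (`d ≡ 1 (4)` square-free `≠ 1`, or `d = 4m`,
`m ≡ 2, 3 (4)` square-free) has `|d| ≥ 3`. [folklore] -/
theorem three_le_natAbs_of_fundDiscrShape {d : ℤ}
    (hd : (d % 4 = 1 ∧ Squarefree d ∧ d ≠ 1) ∨
      (4 ∣ d ∧ (d / 4 % 4 = 2 ∨ d / 4 % 4 = 3) ∧ Squarefree (d / 4))) :
    3 ≤ d.natAbs := by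
  rcases hd with ⟨h1, -, h2⟩ | ⟨h1, h2, -⟩ <;> omega

/-- **`d_K < −4` for a genus field**: if the discriminant of the imaginary quadratic field `K` factors as
`d_K = d₁·d₂` with both `dᵢ` fundamental discriminants `≠ 1`, then `d_K ≤ −9 < −4` (so `𝒪_K^× = {±1}`).
[folklore] -/
theorem discr_lt_neg_four_of_genus {K : Type} [Field K] [NumberField K] (hK : IsImaginaryQuadratic K)
    {d₁ d₂ : ℤ}
    (hd₁ : (d₁ % 4 = 1 ∧ Squarefree d₁ ∧ d₁ ≠ 1) ∨
      (4 ∣ d₁ ∧ (d₁ / 4 % 4 = 2 ∨ d₁ / 4 % 4 = 3) ∧ Squarefree (d₁ / 4)))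
    (hd₂ : (d₂ % 4 = 1 ∧ Squarefree d₂ ∧ d₂ ≠ 1) ∨
      (4 ∣ d₂ ∧ (d₂ / 4 % 4 = 2 ∨ d₂ / 4 % 4 = 3) ∧ Squarefree (d₂ / 4)))
    (hd : d₁ * d₂ = NumberField.discr K) : NumberField.discr K < -4 := by
  have hneg := hK.discr_neg
  have h1 := three_le_natAbs_of_fundDiscrShape hd₁
  have h2 := three_le_natAbs_of_fundDiscrShape hd₂
  have h9 : 9 ≤ (NumberField.discr K).natAbs := by
    rw [← hd, Int.natAbs_mul]
    nlinarith
  omega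

/-! ### §2 S2 for a general presentation, modulo the four printed facts -/

variable {K : Type} [Field K] [NumberField K]

/-- **S2 `stub_genusKolyvaginPointsRC` UNBUNDLED, for a GENERAL globally minimal `W` presented as
`C₂ • (D • E′)^{(d₁)} = W`.** Data: an imaginary quadratic `K` with a complex embedding `ιc`; the fourth curve `E′`
(globally minimal) with `D • E′` in `a₁ = a₃ = 0` form; the genus factorisation `d_K = d₁·d₂` into fundamental
discriminants `≠ 1`; `E′ ≅ W^{(d₁)}`; a parametrisation datum `Dt` of `E′` at level `N_{E′}` with a Birch
orientation `β`; `θ = √d₁ ∈ K[1]` with its genus signs `s(σ)`; the conductor-one CM point `y ∈ E′(K[1])`; and the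
transported genus point `P ∈ W(K)` with `P↑ = congr_{hWd}(Φ(Σ_τ s(τ)·τy))` (the field `hP` of the line's
`GenusHeegnerSettingRC`, verbatim); `p ≥ 5` with `ρ̄_{W,p}` onto. Conclusion: the body of the line's
`GenusKolyvaginPointsR W p K ιc P`, VERBATIM. Proof: substitute the presentation, read `d_K < −4` off the genus
factorisation (§1), and apply `GenusKolyvagin.genusKolyvaginPointsR_of_facts` (cell `bsd-addord`). Conditional on
the four named facts `hG1`, `hNek`, `hP53`, `hmodP` (hypotheses).
[cite: GrossLMS1991, §§3–5 (Props. 3.7, 5.3, 5.4)] [cite: McCallumLMS1991, §4 (4)–(6), Prop. 4.4]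
[cite: Nekovar2007, Prop. 4.9] [cite: Darmon2004, Thm. 3.6] -/
theorem genusKolyvaginPointsR_of_presentation
    (hG1 : ∀ (N : ℕ) [NeZero N] (W : WeierstrassCurve ℚ) (K : Type) [Field K] [NumberField K],
      phi_heegnerPointOfConductor_mem_range_map_ringClassField_birch N W K)
    (hNek : Nekovar2007.cmPoint_frobeniusCongruence)
    (hP53 : ∀ (N : ℕ) [NeZero N] (W : WeierstrassCurve ℚ) (K : Type) [Field K] [NumberField K],
      GrossLMS1991.prop53_conj_pinned_birch N W K)
    (hmodP : nonempty_modularParametrizationData)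
    (W : WeierstrassCurve ℚ) [W.IsElliptic] [W.IsGloballyMinimal] {p : ℕ} [Fact p.Prime] (hp5 : 5 ≤ p)
    (hsurj : W.HasSurjectiveModNGaloisRep p)
    (hK : IsImaginaryQuadratic K) (ιc : K →+* ℂ)
    (E' : WeierstrassCurve ℚ) [E'.IsElliptic] [E'.IsGloballyMinimal] [NeZero (E'.conductorNorm ℤ)]
    (D C₂ : VariableChange ℚ) [(D • E').IsCharNeTwoNF] {d₁ d₂ : ℤ}
    (hd₁ : (d₁ % 4 = 1 ∧ Squarefree d₁ ∧ d₁ ≠ 1) ∨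
      (4 ∣ d₁ ∧ (d₁ / 4 % 4 = 2 ∨ d₁ / 4 % 4 = 3) ∧ Squarefree (d₁ / 4)))
    (hd₂ : (d₂ % 4 = 1 ∧ Squarefree d₂ ∧ d₂ ≠ 1) ∨
      (4 ∣ d₂ ∧ (d₂ / 4 % 4 = 2 ∨ d₂ / 4 % 4 = 3) ∧ Squarefree (d₂ / 4)))
    (hd : d₁ * d₂ = NumberField.discr K)
    (hE' : ∃ C : VariableChange ℚ, C • W.quadraticTwist (d₁ : ℚ) = E')
    (hWd : C₂ • (D • E').quadraticTwist (d₁ : ℚ) = W)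
    (Dt : ModularParametrizationData E' (E'.conductorNorm ℤ)) {β : ℤ}
    (hβ : (4 * (E'.conductorNorm ℤ : ℤ)) ∣ β ^ 2 - NumberField.discr K)
    {θ : ringClassField K ιc 1} (hθ2 : θ ^ 2 = algebraMap ℚ (ringClassField K ιc 1) (d₁ : ℚ)) (hθ0 : θ ≠ 0)
    (s : ringClassGal ιc 1 → ℤˣ)
    (hθσ : ∀ σ : ringClassGal ιc 1, σ.1 θ = ((s σ : ℤ) : ringClassField K ιc 1) * θ)
    {y : (E'.baseChange (ringClassField K ιc 1)).toAffine.Point}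
    (hy : Affine.Point.map (ringClassField K ιc 1).subtype.toRatAlgHom y =
      heegnerPointComplexOfConductor Dt (NumberField.discr K) β 1)
    {instF : Fintype (ringClassGal ιc 1)}
    {P : (W.baseChange K).toAffine.Point}
    (hP : Affine.Point.map (algebraMap K (ringClassField K ιc 1)).toRatAlgHom P =
      Affine.Point.congrEquiv
        (congrArg (fun X : WeierstrassCurve ℚ ↦ X.baseChange (ringClassField K ιc 1 : Type)) hWd)
        (VariableChange.pointEquivBaseChange ((D • E').quadraticTwist (d₁ : ℚ)) C₂ (ringClassField K ιc 1)
          ((VariableChange.pointEquiv (((D • E').quadraticTwist (d₁ : ℚ)).baseChange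
              (ringClassField K ιc 1 : Type)) (untwistAt hθ0)).symm
            ((Affine.Point.congrEquiv (untwistAt_smul_eq (D • E') hθ2 hθ0)).symm
              (VariableChange.pointEquivBaseChange E' D (ringClassField K ιc 1)
                (∑ τ : ringClassGal ιc 1,
                  (s τ : ℤ) • pointGalHom E' (ringClassField K ιc 1 : Type) τ.1 y)))))) :
    ∀ {M : ℕ} (_hM : 1 ≤ M)
      (hdiv : ∀ Q : geomPoints (W.baseChange K), ∃ R, ((p ^ M : ℕ) : ℤ) • R = Q)
      (c : K ≃ₐ[ℚ] K) (_hc : c ≠ 1),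
      ∃ (ε : ℤ) (τ : AlgebraicClosure K ≃+* AlgebraicClosure K) (hτ : IsLiftOfAut c τ)
        (A : ℕ → AddSubgroup (geomPoints (W.baseChange K)))
        (hA : ∀ m, KolyvaginCocycle.IsAdmissible (Field.absoluteGaloisGroup K) (A m)
          ((p ^ M : ℕ) : ℤ))
        (emb : ∀ m : ℕ, ringClassField K ιc m →ₐ[K] AlgebraicClosure K)
        (Pt : ℕ → geomPoints (W.baseChange K))
        (hPt : ∀ m, Pt m ∈
          KolyvaginCocycle.invPoints (Field.absoluteGaloisGroup K) (A m) ((p ^ M : ℕ) : ℤ)),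
        (ε = 1 ∨ ε = -1) ∧
        IsOfFinAddOrder (Affine.Point.map (W' := W) (c : K →ₐ[ℚ] K) P - ε • P) ∧
        (∀ m, ∀ a ∈ A m, hτ.pointsMap W a ∈ A m) ∧
        Pt 1 = toGeomPoints (W.baseChange K) P ∧
        (∀ m, m ≠ 0 → ∀ a ∈ A m, ∀ Φ : Field.absoluteGaloisGroup K,
          (∀ x : ringClassField K ιc m, Φ • emb m x = emb m x) → Φ • a = a) ∧
        (∀ m : ℕ, Squarefree m →
          (∀ q ∈ m.primeFactors, IsKolyvaginPrime (W.conductorNorm ℤ) W K p q ∧ FrobEqFrobInfty W K (p ^ M) q) →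
          (∃ B ∈ A m, hτ.pointsMap W (Pt m) =
            (ε * (-1) ^ m.primeFactors.card) • Pt m + ((p ^ M : ℕ) : ℤ) • B) ∧
          (∀ ℓ : ℕ, ℓ.Prime → ℓ ∣ m → ∀ v : HeightOneSpectrum (𝓞 K), (ℓ : 𝓞 K) ∈ v.asIdeal →
            ∀ a : ℕ, (((p : ℤ) ^ a) •
                kolyvaginClass (W.baseChange K) _ hdiv (hA m) (Pt m) (hPt m) ∈
                selmerLocalKer (W.baseChange K) (v.adicCompletion K) ((p ^ M : ℕ) : ℤ) ↔
              ((p : ℤ) ^ a) • kolyvaginClass (W.baseChange K) _ hdiv (hA (m / ℓ)) (Pt (m / ℓ))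
                  (hPt (m / ℓ)) ∈
                (W.baseChange K).torsionLocalKer (v.adicCompletion K) ((p ^ M : ℕ) : ℤ)))) := by
  subst hWd
  have hD4 : NumberField.discr K < -4 := discr_lt_neg_four_of_genus hK hd₁ hd₂ hd
  have hd₁K : d₁ ∣ NumberField.discr K := hd ▸ dvd_mul_right d₁ d₂
  intro M hM hdiv c hc
  exact GenusKolyvagin.genusKolyvaginPointsR_of_facts hG1 hNek hP53 hmodP hK hD4 ιc E' D C₂ d₁ hE' hd₁K Dt hβ
    hθ2 hθ0 s hθσ hy hP hp5 hsurj hM hdiv c hc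

end Summit.BirchSwinnertonDyer.BirchSwinnertonDyer.Theorems.GenusKolyvaginRC

end
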